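import Literature.NumberTheory.EllipticCurves.LatticeHomOfCurveKernelProofs
import Literature.NumberTheory.EllipticCurves.IsogenyBaseChange
import Literature.NumberTheory.EllipticCurves.VariableChangePoints
import Literature.NumberTheory.EllipticCurves.DivisionPolynomialTorsion
import Literature.NumberTheory.EllipticCurves.UniformizationUniqueProofs
import Literature.NumberTheory.EllipticCurves.RealLatticePeriod
import HarnessLib

/-!
# The complex points of an isogeny: `ψ_ℂ(u(z)) = u'(αz)` on the uniformizations of the given models

Topic `NumberTheory/EllipticCurves`; a proofs-only file (theorems only: no definitions, no named
facts), with deliberate dot-notation extensions of Mathlib's `WeierstrassCurve` /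
`WeierstrassCurve.Affine.Point` namespaces (as in the sibling files `IsogenyBaseChange.lean`,
`LatticeHomOfCurve*.lean`); generic helpers live in
`namespace Literature.NumberTheory.EllipticCurves`.

Setting: `K` a field with a fixed embedding into `ℂ` (`[Algebra K ℂ]`) and a compatible embedding
`K̄ → ℂ` of its algebraic closure (`[Algebra (AlgebraicClosure K) ℂ] [IsScalarTower K K̄ ℂ]`);
`ψ : W → W'` an isogeny of elliptic curves over `K` in the sense of the tree
(`WeierstrassCurve.Isogeny`: its `Γ_K`-equivariant, generically rational action on `K̄`-points);
`Φ = ψ_ℂ : W(ℂ) → W'(ℂ)` its base change to complex points (`Isogeny.baseChange`, file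
`IsogenyBaseChange`); `Λ, Λ'` period lattices with `g₂ = c₄/12`, `g₃ = c₆/216` for the two
*given* models and `u, u'` the uniformizations `z ↦ (℘(z) − b₂/12, (℘'(z) − a₁x − a₃)/2)` of
`W(ℂ)`, `W'(ℂ)` (`PeriodPair.exists_addMonoidHom_of_g₂_g₃`, entering through their characterising
properties `hker`, `hu`).

* **`Isogeny.exists_mul_baseChange_apply_eq_formula`** (Silverman, *AEC*, Thm. VI.4.1(b), for
  all complex points of the given models, with III.5): there is `α ≠ 0` with `αΛ ⊆ Λ'`,
  `Φ(u(z)) = u'(αz)` for *every* `z ∈ ℂ`, `#ker Φ = [Λ' : αΛ]`, and **`ψ^*ω' = αω` in the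
  coordinates of the given models**: for every rational representation `(P₁/Q₁, P₂/Q₂)` of `ψ`
  and every affine `(x, y) ∈ W(ℂ)`,
  `α · (Q₁(2P₂Q₁² + a₁'P₁Q₁Q₂ + a₃'Q₁²Q₂))(x, y) = (Q₁Q₂(δP₁·Q₁ − P₁·δQ₁))(x, y)`
  (`δ` the invariant derivation `f ↦ df/ω`, `WeierstrassCurve.invariantDerivation`);
  `Isogeny.exists_mul_baseChange_apply_eq` is the analytic part alone.  The tree's
  `PeriodPair.exists_mul_of_curve_hom_apply` (`LatticeHomOfCurveKernelProofs`) is applied to `Φ`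
  on `M₁ = W(ℂ)` itself, embedded in `E_Λ(ℂ)` through the change of variables to the short model
  (`toShortNF_smul_eq_curve`, `VariableChange.pointEquiv`): `Φ` is given by the transported
  rational representation of `ψ` at the images of the non-exceptional `K̄`-points
  (`Isogeny.baseChange_map`) and at all other points, which are generic
  (`Isogeny.baseChangeFun_eq_evalPt`), so the failure set is finite; the coordinate identity of
  that theorem for the short models is pulled back along the changes of variables, which have
  `u = 1` and therefore preserve `δ` (`invariantDerivation_smul_bind₁`, with the Leibniz rule
  `invariantDerivation_mul`).
* For `K ⊆ ℝ` (`[Algebra K ℝ] [IsScalarTower K ℝ ℂ]`): `isReal_of_g₂_g₃_eq` (the lattice is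
  real), **`apply_conj_eq_map_of_uniformization`** (`u(conj z) = conj u(z)`),
  **`range_map_eq_map_realLocus_of_uniformization`** (the real points `W(ℝ) ≤ W(ℂ)` are
  `u({z | conj z − z ∈ Λ})`; Silverman, *ATAEC*, V.2) and **`Isogeny.map_conj_baseChange`**
  (`Φ` commutes with complex conjugation: `Isogeny.map_baseChange` for `conj`, which restricts
  on `K̄` to an element of `Γ_K`).

Used by `IsogenyRealPeriodProofs.lean` (the archimedean local factor of an isogeny, Milne,
*Arithmetic Duality Theorems*, proof of Thm. I.7.3).

## References

* J. H. Silverman, *The Arithmetic of Elliptic Curves*, 2nd ed., GTM 106 (2009), Thm. VI.4.1(b)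
  (PDF pp. 152–154), III.1 (changes of variables), I.§3 (`φ(P)^σ = φ^σ(P^σ)`).
  [SilvermanAEC2009]
* J. H. Silverman, *Advanced Topics in the Arithmetic of Elliptic Curves*, GTM 151, V.2.
-/

noncomputable section

open scoped Classical ComplexConjugate

namespace WeierstrassCurve

/-! ### Small helpers -/

/-- Points of equal Weierstrass curves correspond (transport along the equality), affine points
to the affine points with the same coordinates. A deliberate dot-notation extension of Mathlib's
`WeierstrassCurve.Affine.Point` (cf. the tree's `WeierstrassCurve.exists_addEquiv_of_eq`, which
also transports local heights). [folklore] -/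
theorem Affine.Point.exists_addEquiv_of_eq {F : Type*} [Field F] {V V' : WeierstrassCurve F}
    (h : V = V') :
    ∃ e : V.toAffine.Point ≃+ V'.toAffine.Point,
      ∀ (x y : F) (hxy : V.toAffine.Nonsingular x y), ∃ h', e (.some x y hxy) = .some x y h' := by
  subst h
  exact ⟨AddEquiv.refl _, fun x y hxy ↦ ⟨hxy, rfl⟩⟩

variable {R : Type*} [CommRing R]

/-- The Leibniz rule for `δ`: `δ(fg) = δf·g + f·δg`. [folklore] -/
theorem invariantDerivation_mul (W : WeierstrassCurve R) (f g : MvPolynomial (Fin 2) R) :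
    W.invariantDerivation (f * g) =
      W.invariantDerivation f * g + f * W.invariantDerivation g := by
  simp only [invariantDerivation, Derivation.leibniz, smul_eq_mul]
  ring

/-- **The invariant derivation is invariant under changes of variables with `u = 1`.**  For
`C = (1, r, s, t)` (so that the invariant differential `ω = dx/(2y + a₁x + a₃)` is unchanged,
`ω' = u⁻¹ω`, Silverman, *AEC*, III.1 Table 3.1) and the substitution
`S : f(x, y) ↦ f(X + r, Y + sX + t)` expressing the old coordinates through the new ones
(`x = u²X + r`, `y = u³Y + su²X + t`), one has `δ_{C • W}(S f) = S(δ_W f)`: both sides are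
derivations along `S` agreeing on `x` and `y` (`2Y + a₁'X + a₃' = 2y + a₁x + a₃` and
`3X² + 2a₂'X + a₄' − a₁'Y = (3x² + 2a₂x + a₄ − a₁y) − s(2y + a₁x + a₃)` under the substitution).
[cite: SilvermanAEC2009, III.1 Table 3.1] -/
theorem invariantDerivation_smul_bind₁ (W : WeierstrassCurve R) (C : VariableChange R)
    (hu : C.u = 1) (f : MvPolynomial (Fin 2) R) :
    (C • W).invariantDerivation
        (MvPolynomial.bind₁ ![MvPolynomial.X 0 + MvPolynomial.C C.r,
          MvPolynomial.X 1 + MvPolynomial.C C.s * MvPolynomial.X 0 + MvPolynomial.C C.t] f) =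
      MvPolynomial.bind₁ ![MvPolynomial.X 0 + MvPolynomial.C C.r,
          MvPolynomial.X 1 + MvPolynomial.C C.s * MvPolynomial.X 0 + MvPolynomial.C C.t]
        (W.invariantDerivation f) := by
  set g : Fin 2 → MvPolynomial (Fin 2) R := ![MvPolynomial.X 0 + MvPolynomial.C C.r,
    MvPolynomial.X 1 + MvPolynomial.C C.s * MvPolynomial.X 0 + MvPolynomial.C C.t] with hg
  have hg0 : g 0 = MvPolynomial.X 0 + MvPolynomial.C C.r := rfl
  have hg1 : g 1 = MvPolynomial.X 1 + MvPolynomial.C C.s * MvPolynomial.X 0 + MvPolynomial.C C.t :=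
    rfl
  -- the generators
  have hX : ∀ i : Fin 2, (C • W).invariantDerivation (MvPolynomial.bind₁ g (MvPolynomial.X i)) =
      MvPolynomial.bind₁ g (W.invariantDerivation (MvPolynomial.X i)) := by
    intro i
    fin_cases i
    · simp only [Fin.zero_eta, MvPolynomial.bind₁_X_right, hg0, invariantDerivation_def,
        map_add, MvPolynomial.pderiv_C, MvPolynomial.pderiv_X_self,
        MvPolynomial.pderiv_X_of_ne (show (0 : Fin 2) ≠ 1 by decide), add_zero, one_mul,
        zero_mul, map_mul, MvPolynomial.bind₁_C_right, MvPolynomial.bind₁_X_right, hg1,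
        variableChange_a₁, variableChange_a₃, hu, inv_one, Units.val_one, one_pow, map_ofNat]
      ring
    · simp only [Fin.mk_one, MvPolynomial.bind₁_X_right, hg1, invariantDerivation_def,
        map_add, map_mul, MvPolynomial.pderiv_C, MvPolynomial.pderiv_X_self,
        MvPolynomial.pderiv_C_mul, MvPolynomial.pderiv_X_of_ne (show (0 : Fin 2) ≠ 1 by decide),
        MvPolynomial.pderiv_X_of_ne (show (1 : Fin 2) ≠ 0 by decide), add_zero, zero_add,
        one_mul, zero_mul, mul_zero, mul_one, MvPolynomial.bind₁_C_right,
        MvPolynomial.bind₁_X_right, hg0, map_pow, map_sub,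
        variableChange_a₁, variableChange_a₂, variableChange_a₃, variableChange_a₄, hu, inv_one,
        Units.val_one, one_pow, map_ofNat]
      ring
  induction f using MvPolynomial.induction_on with
  | C a =>
    rw [MvPolynomial.bind₁_C_right, invariantDerivation_C, invariantDerivation_C, map_zero]
  | add p q hp hq =>
    rw [map_add, invariantDerivation_add, invariantDerivation_add, map_add, hp, hq]
  | mul_X p i hp =>
    rw [map_mul, invariantDerivation_mul, hp, hX i, invariantDerivation_mul, map_add, map_mul,
      map_mul]

end WeierstrassCurve

namespace Literature.NumberTheory.EllipticCurves

variable {K : Type*} [Field K] [Algebra (AlgebraicClosure K) ℂ]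

/-- Evaluating the base change to `ℂ` of a polynomial over `K̄` at `(ι x, ι y)`. [folklore] -/
theorem eval_map_algebraMap_vec₂ (P : MvPolynomial (Fin 2) (AlgebraicClosure K))
    (x y : AlgebraicClosure K) :
    MvPolynomial.eval ![algebraMap (AlgebraicClosure K) ℂ x, algebraMap (AlgebraicClosure K) ℂ y]
        (MvPolynomial.map (algebraMap (AlgebraicClosure K) ℂ) P) =
      algebraMap (AlgebraicClosure K) ℂ (MvPolynomial.eval ![x, y] P) := by
  have hv : (⇑(algebraMap (AlgebraicClosure K) ℂ)) ∘ ![x, y] =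
      ![algebraMap (AlgebraicClosure K) ℂ x, algebraMap (AlgebraicClosure K) ℂ y] := by
    funext i
    fin_cases i <;> rfl
  rw [MvPolynomial.map_eval (algebraMap (AlgebraicClosure K) ℂ) ![x, y] P, hv]

/-- Evaluating the base change to `ℂ` of a polynomial over `K̄` is `aeval`. [folklore] -/
theorem eval_map_algebraMap_eq_aeval (P : MvPolynomial (Fin 2) (AlgebraicClosure K))
    (v : Fin 2 → ℂ) :
    MvPolynomial.eval v (MvPolynomial.map (algebraMap (AlgebraicClosure K) ℂ) P) =
      MvPolynomial.aeval v P := by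
  rw [MvPolynomial.eval_map, MvPolynomial.aeval_def]

/-- Evaluation of an affine substitution `x ↦ X + r`, `y ↦ Y + sX + t` (`bind₁`). [folklore] -/
theorem eval_bind₁_affine (r s t : ℂ) (P : MvPolynomial (Fin 2) ℂ) (X Y : ℂ) :
    MvPolynomial.eval ![X, Y]
        (MvPolynomial.bind₁
          ![MvPolynomial.X 0 + MvPolynomial.C r,
            MvPolynomial.X 1 + MvPolynomial.C s * MvPolynomial.X 0 + MvPolynomial.C t] P) =
      MvPolynomial.eval ![X + r, Y + s * X + t] P := by
  change MvPolynomial.eval₂Hom (RingHom.id _) ![X, Y] (MvPolynomial.bind₁ _ P) = _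
  rw [MvPolynomial.eval₂Hom_bind₁]
  change MvPolynomial.eval _ P = _
  congr 2
  funext i
  fin_cases i <;> simp

end Literature.NumberTheory.EllipticCurves

namespace WeierstrassCurve

open PeriodPair Literature.NumberTheory.EllipticCurves

variable {K : Type*} [Field K] [Algebra K ℂ] [Algebra (AlgebraicClosure K) ℂ]
  [IsScalarTower K (AlgebraicClosure K) ℂ]

/-! ### The base change of an isogeny is `z ↦ αz` on the uniformizations of the given models -/

/-- **Silverman, *AEC*, Thm. VI.4.1(b) for the complex points of the given models.**  Let
`ψ : W → W'` be an isogeny of elliptic curves over a subfield `K` of `ℂ` (recorded, as in the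
tree, by its `Γ_K`-equivariant, generically rational action on `K̄`-points, `K̄ → ℂ` a fixed
`K`-embedding), `Φ = ψ_ℂ : W(ℂ) → W'(ℂ)` its base change to complex points
(`Isogeny.baseChange`), `Λ, Λ'` period lattices with `g₂ = c₄/12`, `g₃ = c₆/216` for the two
models and `u : ℂ/Λ ≃ W(ℂ)`, `u' : ℂ/Λ' ≃ W'(ℂ)` the uniformizations
`z ↦ (℘(z) − b₂/12, (℘'(z) − a₁x − a₃)/2)` (`PeriodPair.exists_addMonoidHom_of_g₂_g₃`).  Then
there is `α ≠ 0` with `αΛ ⊆ Λ'`, **`Φ(u(z)) = u'(αz)` for every `z ∈ ℂ`**, and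
`#ker Φ = [Λ' : αΛ]`.  Proof: transport to the short models `E_Λ, E_{Λ'}`
(`toShortNF_smul_eq_curve`, the point isomorphisms of the changes of variables) and apply the
tree's `PeriodPair.exists_mul_of_curve_hom_apply` to `Φ` on *all* complex points: `Φ` is given
by the (transported) rational representation of `ψ` at the images of the non-exceptional
`K̄`-points (`Isogeny.baseChange_map`) and at every other point, these being generic
(`Isogeny.baseChangeFun_eq_evalPt`, `RatRep.evalPt_eq_some_of_generic`), so the failure set is
finite; the kernel count is `PeriodPair.card_ker_eq_relIndex_of_apply_eq`.  Moreover the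
multiplier satisfies **`ψ^*ω' = αω` in the coordinates of the given models** (Silverman, *AEC*,
III.5): for every rational representation `(P₁/Q₁, P₂/Q₂)` of `ψ` and every affine point
`(x, y) ∈ W(ℂ)`,
`α · (Q₁(2P₂Q₁² + a₁'P₁Q₁Q₂ + a₃'Q₁²Q₂))(x, y) = (Q₁Q₂(δP₁·Q₁ − P₁·δQ₁))(x, y)`, `δ = δ_W` the
invariant derivation and `a₁', a₃'` the coefficients of `W'` — that is,
`α (2y' + a₁'x' + a₃') = δ(x')` for `(x', y') = (P₁/Q₁, P₂/Q₂)`, cleared of denominators (the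
coordinate identity of `exists_mul_of_curve_hom_apply` for the short models, pulled back along
the changes of variables with `u = 1`, under which `δ` is invariant,
`invariantDerivation_smul_bind₁`).
[cite: SilvermanAEC2009, Thm. VI.4.1(b) (PDF pp. 152–154), III.5 (PDF p. 75)] -/
theorem Isogeny.exists_mul_baseChange_apply_eq_formula {W W' : WeierstrassCurve K}
    [W.IsElliptic] [W'.IsElliptic] (ψ : Isogeny W W') {L L' : PeriodPair}
    (h₂ : L.g₂ = (W.baseChange ℂ).c₄ / 12) (h₃ : L.g₃ = (W.baseChange ℂ).c₆ / 216)
    (h₂' : L'.g₂ = (W'.baseChange ℂ).c₄ / 12) (h₃' : L'.g₃ = (W'.baseChange ℂ).c₆ / 216)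
    (u : ℂ →+ (W.baseChange ℂ).toAffine.Point) (hker : (u.ker : Set ℂ) = L.lattice)
    (hu : ∀ z ∉ L.lattice, ∃ hz, u z = .some (℘[L] z - (W.baseChange ℂ).b₂ / 12)
        ((℘'[L] z - (W.baseChange ℂ).a₁ * (℘[L] z - (W.baseChange ℂ).b₂ / 12) -
          (W.baseChange ℂ).a₃) / 2) hz)
    (u' : ℂ →+ (W'.baseChange ℂ).toAffine.Point) (hker' : (u'.ker : Set ℂ) = L'.lattice)
    (hu' : ∀ z ∉ L'.lattice, ∃ hz, u' z = .some (℘[L'] z - (W'.baseChange ℂ).b₂ / 12)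
        ((℘'[L'] z - (W'.baseChange ℂ).a₁ * (℘[L'] z - (W'.baseChange ℂ).b₂ / 12) -
          (W'.baseChange ℂ).a₃) / 2) hz) :
    ∃ (α : ℂ) (hα : α ≠ 0), (∀ l ∈ L.lattice, α * l ∈ L'.lattice) ∧
      (∀ z, ψ.baseChange (u z) = u' (α * z)) ∧
      Nat.card (ψ.baseChange (M := ℂ)).ker =
        (L.mulLeft α hα).lattice.toAddSubgroup.relIndex L'.lattice.toAddSubgroup ∧
      ∀ (ρ : RatRep W W' ψ) (x y : ℂ), (W.baseChange ℂ).toAffine.Nonsingular x y →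
        α * MvPolynomial.eval ![x, y] (MvPolynomial.map (algebraMap (AlgebraicClosure K) ℂ)
            (ρ.Q₁ * (MvPolynomial.C 2 * ρ.P₂ * ρ.Q₁ ^ 2 +
              MvPolynomial.C (W'.baseChange (AlgebraicClosure K)).a₁ * ρ.P₁ * ρ.Q₁ * ρ.Q₂ +
              MvPolynomial.C (W'.baseChange (AlgebraicClosure K)).a₃ * ρ.Q₁ ^ 2 * ρ.Q₂))) =
          MvPolynomial.eval ![x, y] (MvPolynomial.map (algebraMap (AlgebraicClosure K) ℂ)
            (ρ.Q₁ * ρ.Q₂ *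
              ((W.baseChange (AlgebraicClosure K)).invariantDerivation ρ.P₁ * ρ.Q₁ -
                ρ.P₁ * (W.baseChange (AlgebraicClosure K)).invariantDerivation ρ.Q₁))) := by
  classical
  -- the curves over `ℂ`, the embedding of `K̄`-points, the base change `Φ`
  haveI hWcE : (W.baseChange ℂ).IsElliptic := by
    rw [WeierstrassCurve.baseChange]; infer_instance
  haveI hWcE' : (W'.baseChange ℂ).IsElliptic := by
    rw [WeierstrassCurve.baseChange]; infer_instance
  haveI : Infinite (W.baseChange ℂ).toAffine.Point := (W.baseChange ℂ).infinite_point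
  set ι : AlgebraicClosure K →+* ℂ := algebraMap (AlgebraicClosure K) ℂ with hι
  set ιpt := Affine.Point.map (W' := W) (IsScalarTower.toAlgHom K (AlgebraicClosure K) ℂ)
    with hιpt
  set ιpt' := Affine.Point.map (W' := W') (IsScalarTower.toAlgHom K (AlgebraicClosure K) ℂ)
    with hιpt'
  have hιpt_some : ∀ {x y : AlgebraicClosure K}
      (h : (W.baseChange (AlgebraicClosure K)).toAffine.Nonsingular x y),
      ∃ hns, ιpt (.some x y h) = .some (ι x) (ι y) hns := fun h ↦
    ⟨_, Affine.Point.map_some _ h⟩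
  have hιpt'_some : ∀ {x y : AlgebraicClosure K}
      (h : (W'.baseChange (AlgebraicClosure K)).toAffine.Nonsingular x y),
      ∃ hns, ιpt' (.some x y h) = .some (ι x) (ι y) hns := fun h ↦
    ⟨_, Affine.Point.map_some _ h⟩
  set Φ : (W.baseChange ℂ).toAffine.Point →+ (W'.baseChange ℂ).toAffine.Point := ψ.baseChange
    with hΦ
  -- the short models and the embeddings `f₁, f₂` into `E_Λ(ℂ)`, `E_{Λ'}(ℂ)`
  set C := (W.baseChange ℂ).toShortNF with hC
  set C' := (W'.baseChange ℂ).toShortNF with hC'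
  obtain ⟨e, he⟩ := Affine.Point.exists_addEquiv_of_eq (toShortNF_smul_eq_curve h₂ h₃)
  obtain ⟨e', he'⟩ := Affine.Point.exists_addEquiv_of_eq (toShortNF_smul_eq_curve h₂' h₃')
  set f₁ : (W.baseChange ℂ).toAffine.Point →+ L.curve.toAffine.Point :=
    e.toAddMonoidHom.comp (VariableChange.pointEquiv (W.baseChange ℂ) C).toAddMonoidHom with hf₁
  set f₂ : (W'.baseChange ℂ).toAffine.Point →+ L'.curve.toAffine.Point :=
    e'.toAddMonoidHom.comp (VariableChange.pointEquiv (W'.baseChange ℂ) C').toAddMonoidHom with hf₂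
  have hf₁inj : Function.Injective f₁ :=
    e.injective.comp (VariableChange.pointEquiv (W.baseChange ℂ) C).injective
  have hf₂inj : Function.Injective f₂ :=
    e'.injective.comp (VariableChange.pointEquiv (W'.baseChange ℂ) C').injective
  have hf₁surj : Function.Surjective f₁ :=
    e.surjective.comp (VariableChange.pointEquiv (W.baseChange ℂ) C).surjective
  have hCtoX : ∀ x, C.toX x = x + (W.baseChange ℂ).b₂ / 12 := fun x ↦ by
    rw [VariableChange.toX_def, hC, (W.baseChange ℂ).toShortNF_eq]; simp; ring
  have hCtoY : ∀ x y, C.toY x y = y + ((W.baseChange ℂ).a₁ * x + (W.baseChange ℂ).a₃) / 2 :=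
      fun x y ↦ by
    rw [VariableChange.toY_def, hC, (W.baseChange ℂ).toShortNF_eq]; simp; ring
  have hC'toX : ∀ x, C'.toX x = x + (W'.baseChange ℂ).b₂ / 12 := fun x ↦ by
    rw [VariableChange.toX_def, hC', (W'.baseChange ℂ).toShortNF_eq]; simp; ring
  have hC'toY : ∀ x y,
      C'.toY x y = y + ((W'.baseChange ℂ).a₁ * x + (W'.baseChange ℂ).a₃) / 2 := fun x y ↦ by
    rw [VariableChange.toY_def, hC', (W'.baseChange ℂ).toShortNF_eq]; simp; ring
  have hf₁some : ∀ (x y : ℂ) (h : (W.baseChange ℂ).toAffine.Nonsingular x y),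
      ∃ h', f₁ (.some x y h) = .some (x + (W.baseChange ℂ).b₂ / 12)
        (y + ((W.baseChange ℂ).a₁ * x + (W.baseChange ℂ).a₃) / 2) h' := by
    intro x y h
    obtain ⟨h', he1⟩ :=
      he (C.toX x) (C.toY x y) ((VariableChange.nonsingular_iff (W.baseChange ℂ) C x y).mpr h)
    have hfm : f₁ (.some x y h) = .some (C.toX x) (C.toY x y) h' := by
      simp only [hf₁, AddMonoidHom.coe_comp, Function.comp_apply, AddEquiv.coe_toAddMonoidHom,
        VariableChange.pointEquiv_some]
      exact he1
    exact Affine.Point.exists_eq_some_of_eq hfm (hCtoX x) (hCtoY x y)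
  have hf₂some : ∀ (x y : ℂ) (h : (W'.baseChange ℂ).toAffine.Nonsingular x y),
      ∃ h', f₂ (.some x y h) = .some (x + (W'.baseChange ℂ).b₂ / 12)
        (y + ((W'.baseChange ℂ).a₁ * x + (W'.baseChange ℂ).a₃) / 2) h' := by
    intro x y h
    obtain ⟨h', he1⟩ :=
      he' (C'.toX x) (C'.toY x y) ((VariableChange.nonsingular_iff (W'.baseChange ℂ) C' x y).mpr h)
    have hfm : f₂ (.some x y h) = .some (C'.toX x) (C'.toY x y) h' := by
      simp only [hf₂, AddMonoidHom.coe_comp, Function.comp_apply, AddEquiv.coe_toAddMonoidHom,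
        VariableChange.pointEquiv_some]
      exact he1
    exact Affine.Point.exists_eq_some_of_eq hfm (hC'toX x) (hC'toY x y)
  -- `f₁ ∘ u = π_Λ`, `f₂ ∘ u' = π_{Λ'}`
  have hf₁u : ∀ z, f₁ (u z) = L.toPoint z := by
    intro z
    by_cases hz : z ∈ L.lattice
    · have h0 : u z = 0 := by
        have : z ∈ (u.ker : Set ℂ) := by rw [hker]; exact hz
        exact this
      rw [h0, map_zero, (toPoint_eq_zero_iff (L := L)).mpr hz]
    · obtain ⟨hz', huz⟩ := hu z hz
      obtain ⟨h1, hf1⟩ := hf₁some _ _ hz'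
      rw [huz, hf1, toPoint_of_notMem hz, Affine.Point.some.injEq]
      exact ⟨by ring, by ring⟩
  have hf₂u' : ∀ z, f₂ (u' z) = L'.toPoint z := by
    intro z
    by_cases hz : z ∈ L'.lattice
    · have h0 : u' z = 0 := by
        have : z ∈ (u'.ker : Set ℂ) := by rw [hker']; exact hz
        exact this
      rw [h0, map_zero, (toPoint_eq_zero_iff (L := L')).mpr hz]
    · obtain ⟨hz', huz⟩ := hu' z hz
      obtain ⟨h1, hf1⟩ := hf₂some _ _ hz'
      rw [huz, hf1, toPoint_of_notMem hz, Affine.Point.some.injEq]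
      exact ⟨by ring, by ring⟩
  -- `ker Φ` is finite (it is `ι_* (ker ψ)`), and all of `E_Λ(ℂ)` is in the image of `f₁`
  have hkerΦ : (Φ.ker : Set (W.baseChange ℂ).toAffine.Point).Finite := by
    refine (ψ.finite_ker.image ιpt).subset fun P hP ↦ ?_
    rw [SetLike.mem_coe, AddMonoidHom.mem_ker] at hP
    by_cases hmem : P ∈ Set.range ιpt
    · obtain ⟨P₀, rfl⟩ := hmem
      refine ⟨P₀, ?_, rfl⟩
      have h1 : ιpt' (ψ P₀) = 0 := by
        have h2 := hP
        rw [hΦ, hιpt, Isogeny.baseChange_map] at h2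
        exact h2
      have h3 : ψ P₀ = 0 :=
        (Affine.Point.map_injective (W' := W') _) (h1.trans (map_zero ιpt').symm)
      exact h3
    · exfalso
      rcases P with _ | ⟨x, y, hxy⟩
      · exact hmem ⟨0, map_zero ιpt⟩
      · have h1 := ψ.baseChangeFun_some_of_generic hxy hmem
        rw [hΦ, Isogeny.baseChange_apply] at hP
        rw [hP] at h1
        exact absurd h1.symm (Affine.Point.some_ne_zero _)
  have htors : ∀ n : ℕ, 0 < n → ∀ P : L.curve.toAffine.Point, n • P = 0 → P ∈ f₁.range :=
    fun n _ P _ ↦ hf₁surj P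
  -- the change of variables has `u = 1`: `δ` and the evaluation are compatible with `S`
  have hCr : C.r = -(W.baseChange ℂ).b₂ / 12 := by rw [hC, (W.baseChange ℂ).toShortNF_eq]
  have hCs : C.s = -(W.baseChange ℂ).a₁ / 2 := by rw [hC, (W.baseChange ℂ).toShortNF_eq]
  have hCt : C.t = (W.baseChange ℂ).a₁ * (W.baseChange ℂ).b₂ / 24 - (W.baseChange ℂ).a₃ / 2 := by
    rw [hC, (W.baseChange ℂ).toShortNF_eq]
  have hCu : C.u = 1 := by rw [hC, (W.baseChange ℂ).toShortNF_eq]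
  have hCW : C • W.baseChange ℂ = L.curve := by rw [hC]; exact toShortNF_smul_eq_curve h₂ h₃
  set S : MvPolynomial (Fin 2) ℂ →ₐ[ℂ] MvPolynomial (Fin 2) ℂ :=
    MvPolynomial.bind₁ ![MvPolynomial.X 0 + MvPolynomial.C C.r,
      MvPolynomial.X 1 + MvPolynomial.C C.s * MvPolynomial.X 0 + MvPolynomial.C C.t] with hS
  have hSeval : ∀ (P : MvPolynomial (Fin 2) ℂ) (x y : ℂ),
      MvPolynomial.eval
          ![x + (W.baseChange ℂ).b₂ / 12, y + ((W.baseChange ℂ).a₁ * x + (W.baseChange ℂ).a₃) / 2]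
          (S P) =
        MvPolynomial.eval ![x, y] P := by
    intro P x y
    rw [hS, eval_bind₁_affine]
    have hv : (![x + (W.baseChange ℂ).b₂ / 12 + C.r,
        y + ((W.baseChange ℂ).a₁ * x + (W.baseChange ℂ).a₃) / 2 +
          C.s * (x + (W.baseChange ℂ).b₂ / 12) + C.t] : Fin 2 → ℂ) = ![x, y] := by
      funext i
      fin_cases i
      · simp [hCr]; ring
      · simp [hCs, hCt]; ring
    rw [hv]
  have hδS : ∀ F : MvPolynomial (Fin 2) ℂ,
      L.curve.invariantDerivation (S F) = S ((W.baseChange ℂ).invariantDerivation F) := by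
    intro F
    have h1 := invariantDerivation_smul_bind₁ (W.baseChange ℂ) C hCu F
    rw [hCW] at h1
    rw [hS]
    exact h1
  -- the rational representations, read in `ℂ` and transported to the short coordinates:
  -- `Φ` is given by the transported `ρ` off the (finite) image of the exceptional set of `ρ`
  have halg : ∀ ρ : RatRep W W' ψ, {m : (W.baseChange ℂ).toAffine.Point |
      ¬ ∃ (X Y : ℂ) (h : L.curve.toAffine.Nonsingular X Y),
      f₁ m = .some X Y h ∧ MvPolynomial.eval ![X, Y] (S (MvPolynomial.map ι ρ.Q₁)) ≠ 0 ∧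
        MvPolynomial.eval ![X, Y]
          (S (MvPolynomial.C 2 * MvPolynomial.map ι ρ.Q₁ * MvPolynomial.map ι ρ.Q₂)) ≠ 0 ∧
      ∃ h' : L'.curve.toAffine.Nonsingular
          (MvPolynomial.eval ![X, Y] (S (MvPolynomial.map ι ρ.P₁ +
              MvPolynomial.C ((W'.baseChange ℂ).b₂ / 12) * MvPolynomial.map ι ρ.Q₁)) /
            MvPolynomial.eval ![X, Y] (S (MvPolynomial.map ι ρ.Q₁)))
          (MvPolynomial.eval ![X, Y]
              (S (MvPolynomial.C 2 * MvPolynomial.map ι ρ.P₂ * MvPolynomial.map ι ρ.Q₁ +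
                MvPolynomial.C (W'.baseChange ℂ).a₁ * MvPolynomial.map ι ρ.P₁ *
                  MvPolynomial.map ι ρ.Q₂ +
                MvPolynomial.C (W'.baseChange ℂ).a₃ * MvPolynomial.map ι ρ.Q₁ *
                  MvPolynomial.map ι ρ.Q₂)) /
            MvPolynomial.eval ![X, Y]
              (S (MvPolynomial.C 2 * MvPolynomial.map ι ρ.Q₁ * MvPolynomial.map ι ρ.Q₂))),
        f₂ (Φ m) = .some _ _ h'}.Finite := by
    intro ρ
    set P₁ : MvPolynomial (Fin 2) ℂ := MvPolynomial.map ι ρ.P₁ with hP₁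
    set Q₁ : MvPolynomial (Fin 2) ℂ := MvPolynomial.map ι ρ.Q₁ with hQ₁
    set P₂ : MvPolynomial (Fin 2) ℂ := MvPolynomial.map ι ρ.P₂ with hP₂
    set Q₂ : MvPolynomial (Fin 2) ℂ := MvPolynomial.map ι ρ.Q₂ with hQ₂
    set p₁ : MvPolynomial (Fin 2) ℂ := S (P₁ + MvPolynomial.C ((W'.baseChange ℂ).b₂ / 12) * Q₁)
      with hp₁
    set q₁ : MvPolynomial (Fin 2) ℂ := S Q₁ with hq₁
    set p₂ : MvPolynomial (Fin 2) ℂ :=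
      S (MvPolynomial.C 2 * P₂ * Q₁ + MvPolynomial.C (W'.baseChange ℂ).a₁ * P₁ * Q₂ +
        MvPolynomial.C (W'.baseChange ℂ).a₃ * Q₁ * Q₂) with hp₂
    set q₂ : MvPolynomial (Fin 2) ℂ := S (MvPolynomial.C 2 * Q₁ * Q₂) with hq₂
    -- the computation at a point where `Φ` is given by `(P₁/Q₁, P₂/Q₂)`
    have core : ∀ (x y : ℂ) (hxy : (W.baseChange ℂ).toAffine.Nonsingular x y) (a b c d : ℂ),
        b ≠ 0 → d ≠ 0 →
        MvPolynomial.eval ![x, y] P₁ = a → MvPolynomial.eval ![x, y] Q₁ = b →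
        MvPolynomial.eval ![x, y] P₂ = c → MvPolynomial.eval ![x, y] Q₂ = d →
        (∃ h', Φ (.some x y hxy) = .some (a / b) (c / d) h') →
        ∃ (X Y : ℂ) (h : L.curve.toAffine.Nonsingular X Y), f₁ (.some x y hxy) = .some X Y h ∧
          MvPolynomial.eval ![X, Y] q₁ ≠ 0 ∧ MvPolynomial.eval ![X, Y] q₂ ≠ 0 ∧
          ∃ h' : L'.curve.toAffine.Nonsingular
              (MvPolynomial.eval ![X, Y] p₁ / MvPolynomial.eval ![X, Y] q₁)
              (MvPolynomial.eval ![X, Y] p₂ / MvPolynomial.eval ![X, Y] q₂),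
            f₂ (Φ (.some x y hxy)) = .some _ _ h' := by
      intro x y hxy a b c d hb hd ha hb' hc hd' hΦ'
      obtain ⟨h', hΦ'⟩ := hΦ'
      obtain ⟨h1, hf1⟩ := hf₁some x y hxy
      have hq₁v : MvPolynomial.eval ![x + (W.baseChange ℂ).b₂ / 12,
          y + ((W.baseChange ℂ).a₁ * x + (W.baseChange ℂ).a₃) / 2] q₁ = b := by
        rw [hq₁, hSeval, hb']
      have hq₂v : MvPolynomial.eval ![x + (W.baseChange ℂ).b₂ / 12,
          y + ((W.baseChange ℂ).a₁ * x + (W.baseChange ℂ).a₃) / 2] q₂ =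
          2 * b * d := by
        rw [hq₂, hSeval]
        simp only [map_mul, MvPolynomial.eval_C, hb', hd']
      have hp₁v : MvPolynomial.eval ![x + (W.baseChange ℂ).b₂ / 12,
          y + ((W.baseChange ℂ).a₁ * x + (W.baseChange ℂ).a₃) / 2] p₁ =
          a + (W'.baseChange ℂ).b₂ / 12 * b := by
        rw [hp₁, hSeval]
        simp only [map_add, map_mul, MvPolynomial.eval_C, ha, hb']
      have hp₂v : MvPolynomial.eval ![x + (W.baseChange ℂ).b₂ / 12,
          y + ((W.baseChange ℂ).a₁ * x + (W.baseChange ℂ).a₃) / 2] p₂ =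
          2 * c * b + (W'.baseChange ℂ).a₁ * a * d + (W'.baseChange ℂ).a₃ * b * d := by
        rw [hp₂, hSeval]
        simp only [map_add, map_mul, MvPolynomial.eval_C, ha, hb', hc, hd']
      refine ⟨_, _, h1, hf1, by rw [hq₁v]; exact hb, ?_, ?_⟩
      · rw [hq₂v]
        exact mul_ne_zero (mul_ne_zero two_ne_zero hb) hd
      · obtain ⟨h2, hf2⟩ := hf₂some _ _ h'
        have hP : f₂ (Φ (.some x y hxy)) =
            .some (a / b + (W'.baseChange ℂ).b₂ / 12)
              (c / d + ((W'.baseChange ℂ).a₁ * (a / b) + (W'.baseChange ℂ).a₃) / 2) h2 := by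
          rw [hΦ', hf2]
        refine Affine.Point.exists_eq_some_of_eq hP ?_ ?_
        · rw [hp₁v, hq₁v]
          field_simp
        · rw [hp₂v, hq₂v]
          field_simp
          ring
    -- `Φ` is given by `(p₁/q₁, p₂/q₂)` off the (finite) image of the exceptional set of `ρ`
    refine ((ρ.exc : Set W.geomPoints).toFinite.image ιpt).subset fun m hm ↦ ?_
    by_contra hnot
    apply hm
    by_cases hmem : m ∈ Set.range ιpt
    · obtain ⟨m₀, rfl⟩ := hmem
      have hm₀ : m₀ ∉ ρ.exc := fun h ↦ hnot ⟨m₀, h, rfl⟩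
      rcases m₀ with _ | ⟨x₀, y₀, h₀⟩
      · exact absurd ρ.zero_mem_exc hm₀
      · obtain ⟨hQ₁0, hQ₂0, h', hψ⟩ := ρ.apply_eq_of_not_mem_exc h₀ hm₀
        obtain ⟨hns, hιm⟩ := hιpt_some h₀
        have hΦm : Φ (.some (ι x₀) (ι y₀) hns) = ιpt' (ψ (.some x₀ y₀ h₀)) := by
          rw [← hιm, hΦ, hιpt, hιpt', Isogeny.baseChange_map]
        obtain ⟨hns', hιm'⟩ := hιpt'_some h'
        rw [hψ, hιm'] at hΦm
        rw [hιm]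
        exact core (ι x₀) (ι y₀) hns _ _ _ _ ((map_ne_zero ι).2 hQ₁0) ((map_ne_zero ι).2 hQ₂0)
          (eval_map_algebraMap_vec₂ _ _ _) (eval_map_algebraMap_vec₂ _ _ _)
          (eval_map_algebraMap_vec₂ _ _ _) (eval_map_algebraMap_vec₂ _ _ _)
          (Affine.Point.exists_eq_some_of_eq hΦm (map_div₀ ι _ _) (map_div₀ ι _ _))
    · rcases m with _ | ⟨x, y, hxy⟩
      · exact absurd ⟨0, map_zero ιpt⟩ hmem
      · have hx := (not_mem_range_of_not_mem_range_map hxy hmem).1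
        obtain ⟨hQ₁0, hQ₂0⟩ := ρ.aeval_ne_zero_of_generic hxy hx
        refine core x y hxy _ _ _ _ hQ₁0 hQ₂0 (eval_map_algebraMap_eq_aeval _ _)
          (eval_map_algebraMap_eq_aeval _ _) (eval_map_algebraMap_eq_aeval _ _)
          (eval_map_algebraMap_eq_aeval _ _) ⟨ρ.nonsingular_aeval_of_generic hxy hx, ?_⟩
        rw [hΦ, Isogeny.baseChange_apply, ψ.baseChangeFun_eq_evalPt ρ hxy hmem,
          ρ.evalPt_eq_some_of_generic hxy hx]
  -- the analytic theorem
  obtain ⟨α, hα0, hαΛ, hrep, hformula⟩ :=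
    exists_mul_of_curve_hom_apply L L' Φ hkerΦ f₁ hf₁inj f₂ hf₂inj htors _ _ _ _ (halg ψ.ratRep)
  refine ⟨α, hα0, hαΛ, fun z ↦ hf₂inj ?_,
    card_ker_eq_relIndex_of_apply_eq Φ f₁ hf₁inj f₂ hf₂inj htors hα0 hαΛ hrep,
    fun ρ x y hxy ↦ ?_⟩
  · rw [hrep (u z) z (hf₁u z), hf₂u' (α * z)]
  -- the coordinate identity, pulled back to the coordinates of `W`
  obtain ⟨h1, hf1⟩ := hf₁some x y hxy
  have H := hformula _ _ _ _ (halg ρ) (.some x y hxy) _ _ h1 hf1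
  simp only [map_mul, map_pow, map_sub, map_add, MvPolynomial.eval_C, hδS, hSeval,
    invariantDerivation_add, invariantDerivation_mul, invariantDerivation_C, map_zero, zero_mul,
    zero_add] at H
  have hEQmap : (W.baseChange (AlgebraicClosure K)).map ι = W.baseChange ℂ := by
    simp only [WeierstrassCurve.baseChange, WeierstrassCurve.map_map, hι]
    congr 1
    ext a
    exact (IsScalarTower.algebraMap_apply K (AlgebraicClosure K) ℂ a).symm
  have hEQmap' : (W'.baseChange (AlgebraicClosure K)).map ι = W'.baseChange ℂ := by
    simp only [WeierstrassCurve.baseChange, WeierstrassCurve.map_map, hι]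
    congr 1
    ext a
    exact (IsScalarTower.algebraMap_apply K (AlgebraicClosure K) ℂ a).symm
  have hδmap : ∀ F : MvPolynomial (Fin 2) (AlgebraicClosure K),
      MvPolynomial.map ι ((W.baseChange (AlgebraicClosure K)).invariantDerivation F) =
        (W.baseChange ℂ).invariantDerivation (MvPolynomial.map ι F) := fun F ↦ by
    rw [← invariantDerivation_map, hEQmap]
  have ha₁ι : ι (W'.baseChange (AlgebraicClosure K)).a₁ = (W'.baseChange ℂ).a₁ := by
    rw [← hEQmap']; rfl
  have ha₃ι : ι (W'.baseChange (AlgebraicClosure K)).a₃ = (W'.baseChange ℂ).a₃ := by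
    rw [← hEQmap']; rfl
  simp only [map_mul, map_add, map_sub, map_pow, MvPolynomial.map_C, map_ofNat,
    MvPolynomial.eval_C, hδmap, ha₁ι, ha₃ι]
  linear_combination (1 / 2 : ℂ) * H

/-- **Silverman, *AEC*, Thm. VI.4.1(b) for the complex points of the given models** (the
analytic part of `Isogeny.exists_mul_baseChange_apply_eq_formula`): there is `α ≠ 0` with
`αΛ ⊆ Λ'`, `Φ(u(z)) = u'(αz)` for every `z ∈ ℂ`, and `#ker Φ = [Λ' : αΛ]`.
[cite: SilvermanAEC2009, Thm. VI.4.1(b) (PDF pp. 152–154)] -/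
theorem Isogeny.exists_mul_baseChange_apply_eq {W W' : WeierstrassCurve K} [W.IsElliptic]
    [W'.IsElliptic] (ψ : Isogeny W W') {L L' : PeriodPair}
    (h₂ : L.g₂ = (W.baseChange ℂ).c₄ / 12) (h₃ : L.g₃ = (W.baseChange ℂ).c₆ / 216)
    (h₂' : L'.g₂ = (W'.baseChange ℂ).c₄ / 12) (h₃' : L'.g₃ = (W'.baseChange ℂ).c₆ / 216)
    (u : ℂ →+ (W.baseChange ℂ).toAffine.Point) (hker : (u.ker : Set ℂ) = L.lattice)
    (hu : ∀ z ∉ L.lattice, ∃ hz, u z = .some (℘[L] z - (W.baseChange ℂ).b₂ / 12)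
        ((℘'[L] z - (W.baseChange ℂ).a₁ * (℘[L] z - (W.baseChange ℂ).b₂ / 12) -
          (W.baseChange ℂ).a₃) / 2) hz)
    (u' : ℂ →+ (W'.baseChange ℂ).toAffine.Point) (hker' : (u'.ker : Set ℂ) = L'.lattice)
    (hu' : ∀ z ∉ L'.lattice, ∃ hz, u' z = .some (℘[L'] z - (W'.baseChange ℂ).b₂ / 12)
        ((℘'[L'] z - (W'.baseChange ℂ).a₁ * (℘[L'] z - (W'.baseChange ℂ).b₂ / 12) -
          (W'.baseChange ℂ).a₃) / 2) hz) :
    ∃ (α : ℂ) (hα : α ≠ 0), (∀ l ∈ L.lattice, α * l ∈ L'.lattice) ∧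
      (∀ z, ψ.baseChange (u z) = u' (α * z)) ∧
      Nat.card (ψ.baseChange (M := ℂ)).ker =
        (L.mulLeft α hα).lattice.toAddSubgroup.relIndex L'.lattice.toAddSubgroup := by
  obtain ⟨α, hα, hαΛ, happ, hcard, -⟩ :=
    ψ.exists_mul_baseChange_apply_eq_formula h₂ h₃ h₂' h₃' u hker hu u' hker' hu'
  exact ⟨α, hα, hαΛ, happ, hcard⟩

end WeierstrassCurve

/-! ## Complex conjugation on `W(ℂ)` and the real points `W(ℝ) = u(R)` -/

namespace Literature.NumberTheory.EllipticCurves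

variable {K : Type*} [Field K] [Algebra K ℝ] [Algebra K ℂ] [IsScalarTower K ℝ ℂ]

omit [Algebra K ℝ] [IsScalarTower K ℝ ℂ] in
/-- Complex conjugation is a `K`-algebra endomorphism of `ℂ` as soon as it fixes the image of
`K` (e.g. `K ⊆ ℝ`). [folklore] -/
theorem exists_algHom_conj (hK : ∀ k : K, conj (algebraMap K ℂ k) = algebraMap K ℂ k) :
    ∃ σc : ℂ →ₐ[K] ℂ, ∀ z, σc z = conj z :=
  ⟨{ starRingEnd ℂ with commutes' := hK }, fun _ ↦ rfl⟩

/-- For `K → ℝ → ℂ` a scalar tower, `K` lands in the real numbers: `algebraMap K ℂ k` is the real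
number `algebraMap K ℝ k`. [folklore] -/
theorem ofReal_algebraMap_eq (k : K) : ((algebraMap K ℝ k : ℝ) : ℂ) = algebraMap K ℂ k :=
  (IsScalarTower.algebraMap_apply K ℝ ℂ k).symm

/-- For `K ⊆ ℝ`, complex conjugation fixes `K`. [folklore] -/
theorem conj_algebraMap (k : K) : conj (algebraMap K ℂ k) = algebraMap K ℂ k := by
  rw [← ofReal_algebraMap_eq, Complex.conj_ofReal]

end Literature.NumberTheory.EllipticCurves

namespace WeierstrassCurve

open PeriodPair Literature.NumberTheory.EllipticCurves

variable {K : Type*} [Field K] [Algebra K ℝ] [Algebra K ℂ] [IsScalarTower K ℝ ℂ]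

/-- The period lattice with `g₂ = c₄/12`, `g₃ = c₆/216` of a model over `K ⊆ ℝ` is a real
lattice (Silverman, *AEC*, VI.5.1 uniqueness; *ATAEC*, V.2). [folklore] -/
theorem isReal_of_g₂_g₃_eq {W : WeierstrassCurve K} {L : PeriodPair}
    (h₂ : L.g₂ = (W.baseChange ℂ).c₄ / 12) (h₃ : L.g₃ = (W.baseChange ℂ).c₆ / 216) : L.IsReal := by
  refine isReal_of_g₂_g₃_real uniformization_unique_holds ?_ ?_
  · rw [h₂, WeierstrassCurve.baseChange, map_c₄, ← ofReal_algebraMap_eq]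
    norm_cast
  · rw [h₃, WeierstrassCurve.baseChange, map_c₆, ← ofReal_algebraMap_eq]
    norm_cast

/-- **The uniformization commutes with complex conjugation.**  For a model `W` over `K ⊆ ℝ`,
its real period lattice `Λ` (`g₂ = c₄/12`, `g₃ = c₆/216`) and the uniformization
`u : z ↦ (℘(z) − b₂/12, (℘'(z) − a₁x − a₃)/2)` of `W(ℂ)`: `u(conj z) = conj(u(z))`, complex
conjugation acting on `W(ℂ)` coordinatewise (`Affine.Point.map` of conjugation as a `K`-algebra
map). Indeed `℘_Λ(conj z) = conj ℘_Λ(z)` for a real lattice and the coefficients are real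
(Silverman, *ATAEC*, V.2). [folklore] -/
theorem apply_conj_eq_map_of_uniformization {W : WeierstrassCurve K} {L : PeriodPair}
    (h₂ : L.g₂ = (W.baseChange ℂ).c₄ / 12) (h₃ : L.g₃ = (W.baseChange ℂ).c₆ / 216)
    (u : ℂ →+ (W.baseChange ℂ).toAffine.Point) (hker : (u.ker : Set ℂ) = L.lattice)
    (hu : ∀ z ∉ L.lattice, ∃ hz, u z = .some (℘[L] z - (W.baseChange ℂ).b₂ / 12)
        ((℘'[L] z - (W.baseChange ℂ).a₁ * (℘[L] z - (W.baseChange ℂ).b₂ / 12) -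
          (W.baseChange ℂ).a₃) / 2) hz)
    (σc : ℂ →ₐ[K] ℂ) (hσc : ∀ z, σc z = conj z) (z : ℂ) :
    u (conj z) = Affine.Point.map (W' := W) σc (u z) := by
  have hreal : L.IsReal := isReal_of_g₂_g₃_eq h₂ h₃
  have hb₂ : conj (W.baseChange ℂ).b₂ = (W.baseChange ℂ).b₂ := by
    rw [WeierstrassCurve.baseChange, map_b₂, conj_algebraMap]
  have ha₁ : conj (W.baseChange ℂ).a₁ = (W.baseChange ℂ).a₁ := by
    rw [WeierstrassCurve.baseChange, map_a₁, conj_algebraMap]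
  have ha₃ : conj (W.baseChange ℂ).a₃ = (W.baseChange ℂ).a₃ := by
    rw [WeierstrassCurve.baseChange, map_a₃, conj_algebraMap]
  have hker0 : ∀ w, w ∈ L.lattice → u w = 0 := fun w hw ↦ by
    have : w ∈ (u.ker : Set ℂ) := by rw [hker]; exact hw
    exact this
  by_cases hz : z ∈ L.lattice
  · rw [hker0 z hz, hker0 _ (hreal z hz), map_zero]
  · have hcz : conj z ∉ L.lattice := fun h ↦ hz (by simpa using hreal _ h)
    obtain ⟨h0, e0⟩ := hu z hz
    obtain ⟨h1, e1⟩ := hu _ hcz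
    rw [e0, e1, Affine.Point.map_some, Affine.Point.some.injEq]
    simp only [hσc, map_sub, map_mul, map_div₀, hreal.weierstrassP_conj,
      hreal.derivWeierstrassP_conj, hb₂, ha₁, ha₃, map_ofNat]
    exact ⟨trivial, trivial⟩

/-- **The real points are the image of the real locus.**  In the setting of
`apply_conj_eq_map_of_uniformization`, with `u` onto `W(ℂ)`: the subgroup `W(ℝ) ≤ W(ℂ)` of real
points (the image of `(W ⊗ ℝ)(ℝ)`) is `u(R)`, `R = {z | conj z − z ∈ Λ}` — a point `u(z)` is real
iff it is fixed by conjugation iff `u(conj z − z) = O` (Silverman, *ATAEC*, V.2: `E(ℝ)` is the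
image of the conj-fixed locus of `ℂ/Λ`). [folklore] -/
theorem range_map_eq_map_realLocus_of_uniformization {W : WeierstrassCurve K} {L : PeriodPair}
    (h₂ : L.g₂ = (W.baseChange ℂ).c₄ / 12) (h₃ : L.g₃ = (W.baseChange ℂ).c₆ / 216)
    (u : ℂ →+ (W.baseChange ℂ).toAffine.Point) (hker : (u.ker : Set ℂ) = L.lattice)
    (hu : ∀ z ∉ L.lattice, ∃ hz, u z = .some (℘[L] z - (W.baseChange ℂ).b₂ / 12)
        ((℘'[L] z - (W.baseChange ℂ).a₁ * (℘[L] z - (W.baseChange ℂ).b₂ / 12) -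
          (W.baseChange ℂ).a₃) / 2) hz)
    (hsurj : Function.Surjective u)
    {R : AddSubgroup ℂ} (hR : ∀ z, z ∈ R ↔ conj z - z ∈ L.lattice) :
    (Affine.Point.map (W' := W) (IsScalarTower.toAlgHom K ℝ ℂ)).range = R.map u := by
  obtain ⟨σc, hσc⟩ := exists_algHom_conj (K := K) conj_algebraMap
  have hconj := apply_conj_eq_map_of_uniformization h₂ h₃ u hker hu σc hσc
  have hιapp : ∀ s : ℝ, IsScalarTower.toAlgHom K ℝ ℂ s = (s : ℂ) := fun s ↦ rfl
  -- a point is real iff it is fixed under conjugation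
  have hfix_of_real : ∀ Q : (W.baseChange ℝ).toAffine.Point,
      Affine.Point.map σc (Affine.Point.map (W' := W) (IsScalarTower.toAlgHom K ℝ ℂ) Q) =
        Affine.Point.map (W' := W) (IsScalarTower.toAlgHom K ℝ ℂ) Q := by
    intro Q
    rcases Q with _ | ⟨s, t, hst⟩
    · rfl
    · rw [Affine.Point.map_some, Affine.Point.map_some, Affine.Point.some.injEq, hιapp, hιapp,
        hσc, hσc, Complex.conj_ofReal, Complex.conj_ofReal]
      exact ⟨rfl, rfl⟩
  have hmemker : ∀ w, u w = 0 ↔ w ∈ L.lattice := fun w ↦ by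
    rw [← SetLike.mem_coe, ← hker]; rfl
  ext P
  constructor
  · rintro ⟨Q, rfl⟩
    obtain ⟨z, hz⟩ := hsurj (Affine.Point.map (W' := W) (IsScalarTower.toAlgHom K ℝ ℂ) Q)
    refine ⟨z, ?_, hz⟩
    rw [SetLike.mem_coe, hR, ← hmemker, map_sub, hconj, hz, hfix_of_real, sub_self]
  · rintro ⟨z, hz, rfl⟩
    rw [SetLike.mem_coe, hR, ← hmemker, map_sub, sub_eq_zero, hconj] at hz
    -- `hz : conj (u z) = u z`
    rcases huz : u z with _ | ⟨x, y, hxy⟩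
    · exact ⟨0, map_zero _⟩
    · rw [huz, Affine.Point.map_some, Affine.Point.some.injEq, hσc, hσc] at hz
      obtain ⟨hx, hy⟩ := hz
      have hx' : ((x.re : ℝ) : ℂ) = x := Complex.conj_eq_iff_re.mp hx
      have hy' : ((y.re : ℝ) : ℂ) = y := Complex.conj_eq_iff_re.mp hy
      have hns : (W.baseChange ℝ).toAffine.Nonsingular x.re y.re := by
        refine (W.toAffine.baseChange_nonsingular (B := ℂ)
          (IsScalarTower.toAlgHom K ℝ ℂ).toRingHom.injective x.re y.re).mp ?_
        rw [hιapp, hιapp, hx', hy']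
        exact hxy
      refine ⟨.some x.re y.re hns, ?_⟩
      rw [Affine.Point.map_some, Affine.Point.some.injEq, hιapp, hιapp]
      exact ⟨hx', hy'⟩

end WeierstrassCurve


namespace WeierstrassCurve

variable {K : Type*} [Field K] [Algebra K ℂ] [Algebra (AlgebraicClosure K) ℂ]
  [IsScalarTower K (AlgebraicClosure K) ℂ]

/-- **Complex conjugation commutes with the base change of an isogeny**: for `K ⊆ ℝ` and
`Φ = ψ_ℂ` the base change to `ℂ` of a `K`-isogeny, `conj (Φ P) = Φ (conj P)` — the tree's
semilinear functoriality `Isogeny.map_baseChange` for the `K`-algebra map `conj : ℂ → ℂ`, which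
restricts on `K̄` to an element of `Γ_K` (`AlgHom.restrictNormal'`). Silverman, *AEC*, I.§3
(`φ(P)^σ = φ(P^σ)` for `φ` defined over `K`). [folklore] -/
theorem Isogeny.map_conj_baseChange {W W' : WeierstrassCurve K} (ψ : Isogeny W W')
    (σc : ℂ →ₐ[K] ℂ) (P : (W.baseChange ℂ).toAffine.Point) :
    Affine.Point.map (W' := W') σc (ψ.baseChange P) =
      ψ.baseChange (Affine.Point.map (W' := W) σc P) := by
  set χ : AlgebraicClosure K →ₐ[K] ℂ :=
    σc.comp (IsScalarTower.toAlgHom K (AlgebraicClosure K) ℂ) with hχ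
  set τ₀ : AlgebraicClosure K ≃ₐ[K] AlgebraicClosure K :=
    AlgHom.restrictNormal' χ (AlgebraicClosure K) with hτ₀
  set τ : Field.absoluteGaloisGroup K := (Field.absoluteGaloisGroup.toAlgEquiv K).symm τ₀ with hτ
  refine ψ.map_baseChange σc τ (fun c ↦ ?_) P
  rw [hτ, MulEquiv.apply_symm_apply, hτ₀, AlgHom.restrictNormal', AlgEquiv.coe_ofBijective,
    AlgHom.restrictNormal_commutes]
  simp [hχ]

end WeierstrassCurve
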